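/-
Copyright (c) 2026. All rights reserved.
Released under Apache 2.0 license as described in the file LICENSE.
Authors: abc-iut cell, seat abc-iut-L4-t14 (gen 3; proof-only assembly at the level of the geometric
`EA` of all connected Riemann surfaces finite étale over a fixed `ℍ/Γ̄`: id-rigidity of `EA` and Cor 4.5,
conditional exactly on Lemma-4.3-type slimness of the normalisers — [AbsTopIII] Prop 4.2 (i) p.106).
-/
import Literature.AnabelianGeometry.AbsoluteAnabelian.ArchimedeanHolFieldFunctorGeometricPSLIdRigid
import Literature.AnabelianGeometry.AbsoluteAnabelian.IdRigidLocalCriterion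
import HarnessLib

/-!
# Id-rigidity of the geometric `EA` over `X₀ = ℍ/Γ̄` and Cor 4.5 there, from slimness of the normalisers

S. Mochizuki, *Topics in absolute anabelian geometry III*, proof of Prop 4.2 (i), kurims manuscript
p. 106 l. 14–19 (`paper:url-5493eb38cbb7`; bib key `MochizukiAbsTopIII2015`): "To verify the id-rigidity
of `EA`, it suffices to observe that for any object `X ∈ Ob(EA)` …, the full subcategory of `EA`
consisting of objects that map to `X` may … be identified with … `Loc_R(X)` …. Thus, the id-rigidity of
`EA` follows immediately from the slimness assertion of Lemma 4.3"; Cor 4.5 pp. 107–109.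

PROOF-ONLY assembly (no new notion).  Take for the class `Q` of abc-iut-L4-t14's geometric `EA`
(`geometricAutHolFieldFunctor Q`, p422524) the connected Riemann surfaces finite étale over a fixed
`X₀ = ℍ/Γ̄` (`Γ̄ ≤ PSL₂(ℝ)` acting freely and properly discontinuously; finite-fibre hypothesis `hfin`):
`Q Y := Nonempty (Y ⟶ ℍ/Γ̄)`.  Then print's deduction runs in kernel:

* `HolRS.isIdRigid_mapsTo_in_EA_of` — for `X ∈ EA(Q)`, «objects of `EA(Q)` mapping to `X`» is equivalent
  to «objects of `HolRS` mapping to `X`» (the class `Q` is closed downwards along morphisms), and `X` is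
  isomorphic to some `ℍ/Λ̄`, `Λ̄ ≤ Γ̄` of finite index (`exists_iso_pslLocFunctor_obj`, p439873); so its
  id-rigidity follows from `isIdRigid_mapsTo_pslQuotient_of_isSlimGroup` (p440098) applied to `Λ̄`;
* ★ `HolRS.isIdRigid_EA_mapsTo_pslQuotient` — **`EA(Q)` is ID-RIGID** provided, for every finite-index
  `Λ̄ ≤ Γ̄`, `[N(Λ̄) : Λ̄] < ∞` and the profinite completion of `N(Λ̄) = N_{PSL₂(ℝ)}(Λ̄)` is SLIM
  (print: "Lemma 4.3", here for the orbicurves `[ℍ/N(Λ̄)]`; campaign-L residual J2, NOT proved) —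
  through abc-iut-L4-t14's gen-2 criterion `HolRS.isIdRigid_EA_of_forall_isIdRigid_mapsTo` (p428407);
* ★ `HolRS.cor_4_5_geometric_mapsTo_pslQuotient` — hence [AbsTopIII] Cor 4.5 (i)–(v) for the archimedean
  log-Frobenius data over `EA(Q)` (abc-iut-L4-t10's `cor_4_5_geometric`, p422524/p418xxx chain).

Honest scope: holomorphic morphisms (the RC-category adds the anti-holomorphic coset), trivial
orbi-structure, `hfin`; MODEL ≠ reconstruction; nothing here bears on [IUTchIII] Cor. 3.12; typed ≠ proved.
-/

set_option autoImplicit false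

noncomputable section

open scoped Manifold ContDiff Topology UpperHalfPlane MatrixGroups
open _root_.MulAction _root_.CategoryTheory
open Literature.AlgebraicGeometry.Frobenioids (IsSlimGroup)

namespace Literature.AnabelianGeometry.AbsoluteAnabelian

namespace HolRS

variable (Γ : Subgroup PSL2R) [ProperlyDiscontinuousSMul Γ ℍ] [IsCancelSMul Γ ℍ]
  (hfin : ∀ (g : PSL2R) (Λ₁ Λ₂ : LocObj Γ),
    (∀ x ∈ Λ₁.toSubgroup, g * x * g⁻¹ ∈ Λ₂.toSubgroup) →
    ((Literature.Geometry.Manifold.QuotientManifold.conjSubgroup g Λ₁.toSubgroup).subgroupOf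
      Λ₂.toSubgroup).FiniteIndex)

omit [ProperlyDiscontinuousSMul Γ ℍ] [IsCancelSMul Γ ℍ] in
/-- A finite-index subgroup of a finite-index subgroup `Λ̄ ≤ Γ̄` is an object of `Loc(PSL₂(ℝ), Γ̄)`
(transitivity of finite index). [cite: MochizukiAbsTopIII2015, Proposition 4.2 (i) proof p.106] -/
theorem finiteIndex_subgroupOf_of_locObj (Λ : LocObj Γ) (Λ' : LocObj Λ.toSubgroup) :
    (Λ'.toSubgroup.subgroupOf Γ).FiniteIndex := by
  haveI := Λ.finiteIndex
  haveI := Λ'.finiteIndex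
  refine ⟨fun h0 => ?_⟩
  have h1 : Λ'.toSubgroup.relIndex Λ.toSubgroup ≠ 0 := Subgroup.FiniteIndex.index_ne_zero
  have h2 : Λ.toSubgroup.relIndex Γ ≠ 0 := Subgroup.FiniteIndex.index_ne_zero
  have h3 := Subgroup.relIndex_mul_relIndex (H := Λ'.toSubgroup) (K := Λ.toSubgroup) (L := Γ)
    Λ'.le Λ.le
  rw [show Λ'.toSubgroup.relIndex Γ = 0 from h0, mul_eq_zero] at h3
  rcases h3 with h3 | h3
  · exact h1 h3
  · exact h2 h3

omit [ProperlyDiscontinuousSMul Γ ℍ] [IsCancelSMul Γ ℍ] in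
include hfin in
/-- The finite-fibre hypothesis descends from `Γ̄` to every object `Λ̄`. [cite: MochizukiAbsTopIII2015, Proposition 4.2 (i) proof p.106] -/
theorem hfin_of_locObj (Λ : LocObj Γ) :
    ∀ (g : PSL2R) (Λ₁ Λ₂ : LocObj Λ.toSubgroup),
      (∀ x ∈ Λ₁.toSubgroup, g * x * g⁻¹ ∈ Λ₂.toSubgroup) →
      ((Literature.Geometry.Manifold.QuotientManifold.conjSubgroup g Λ₁.toSubgroup).subgroupOf
        Λ₂.toSubgroup).FiniteIndex :=
  fun g Λ₁ Λ₂ h => hfin g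
    ⟨Λ₁.toSubgroup, Λ₁.le.trans Λ.le, finiteIndex_subgroupOf_of_locObj Γ Λ Λ₁⟩
    ⟨Λ₂.toSubgroup, Λ₂.le.trans Λ.le, finiteIndex_subgroupOf_of_locObj Γ Λ Λ₂⟩ h

/-- **Objects mapping to `X` inside `EA(Q)` ≌ objects mapping to `X` inside `HolRS`** for the class
`Q Y := Nonempty (Y ⟶ ℍ/Γ̄)` (closed downwards along morphisms): the evident functor is fully faithful and
surjective on objects; hence id-rigidity transfers (abc-iut-L4-t12's `isIdRigid_iff_of_equivalence_univ`).
[cite: MochizukiAbsTopIII2015, Proposition 4.2 (i) proof p.106] -/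
theorem isIdRigid_mapsTo_in_EA_iff
    (X : (geometricAutHolFieldFunctor fun Y : HolRS => Nonempty (Y ⟶ pslQuotient Γ)).EA) :
    IsIdRigid (ObjectProperty.FullSubcategory
        fun Y : (geometricAutHolFieldFunctor fun Y : HolRS => Nonempty (Y ⟶ pslQuotient Γ)).EA =>
          Nonempty (Y ⟶ X)) ↔
      IsIdRigid (ObjectProperty.FullSubcategory fun Y : HolRS => Nonempty (Y ⟶ X.obj)) := by
  -- notation
  let Q : ObjectProperty HolRS := fun Y => Nonempty (Y ⟶ pslQuotient Γ)
  let PA : ObjectProperty Q.FullSubcategory := fun Y => Nonempty (Y ⟶ X)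
  let PB : ObjectProperty HolRS := fun Y => Nonempty (Y ⟶ X.obj)
  -- the functor `{Y ∈ EA | Y ⟶ X} ⥤ {Y ∈ HolRS | Y ⟶ X.obj}`
  let Φ : PA.FullSubcategory ⥤ PB.FullSubcategory :=
    ObjectProperty.lift PB (PA.ι ⋙ Q.ι) fun A => A.property.map fun f => f.hom
  -- its inverse on objects
  have hQdown : ∀ {Y : HolRS}, Nonempty (Y ⟶ X.obj) → Q Y := fun ⟨f⟩ =>
    X.property.map fun g => f ≫ g
  let Ψobj : PB.FullSubcategory → PA.FullSubcategory := fun B =>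
    ⟨⟨B.obj, hQdown B.property⟩, B.property.map fun f => ObjectProperty.homMk f⟩
  haveI : Φ.Full := by
    haveI : (PA.ι ⋙ Q.ι).Full := Functor.Full.comp _ _
    infer_instance
  haveI : Φ.Faithful := by
    haveI : (PA.ι ⋙ Q.ι).Faithful := Functor.Faithful.comp _ _
    infer_instance
  haveI : Φ.EssSurj := ⟨fun B => ⟨Ψobj B, ⟨Iso.refl _⟩⟩⟩
  haveI : Φ.IsEquivalence := {}
  exact isIdRigid_iff_of_equivalence_univ Φ.asEquivalence

include hfin

/-- **For `X ∈ EA(Q)`, «objects of `EA(Q)` mapping to `X`» is id-rigid** as soon as, for every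
finite-index `Λ̄ ≤ Γ̄`, `[N(Λ̄) : Λ̄] < ∞` and `N(Λ̄)^` is slim (`X ≅ ℍ/Λ̄_X` for such a `Λ̄_X` by
`exists_iso_pslLocFunctor_obj`; then p440098 for `Λ̄_X`). [cite: MochizukiAbsTopIII2015, Proposition 4.2 (i) proof p.106] -/
theorem isIdRigid_mapsTo_in_EA_of
    (hN : ∀ Λ : LocObj Γ,
      (Λ.toSubgroup.subgroupOf (Subgroup.normalizer (Λ.toSubgroup : Set PSL2R))).FiniteIndex)
    (hslim : ∀ Λ : LocObj Γ, IsSlimGroup (ProfiniteGrp.ProfiniteCompletion.completion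
      (GrpCat.of (Subgroup.normalizer (Λ.toSubgroup : Set PSL2R)))))
    (X : (geometricAutHolFieldFunctor fun Y : HolRS => Nonempty (Y ⟶ pslQuotient Γ)).EA) :
    IsIdRigid (ObjectProperty.FullSubcategory
        fun Y : (geometricAutHolFieldFunctor fun Y : HolRS => Nonempty (Y ⟶ pslQuotient Γ)).EA =>
          Nonempty (Y ⟶ X)) := by
  rw [isIdRigid_mapsTo_in_EA_iff]
  -- `X ≅ ℍ/Λ̄` for a finite-index `Λ̄ ≤ Γ̄`
  obtain ⟨fX⟩ := X.property
  obtain ⟨Λ, ⟨e⟩⟩ := exists_iso_pslLocFunctor_obj Γ hfin X.obj fX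
  haveI : ProperlyDiscontinuousSMul Λ.toSubgroup ℍ :=
    Subgroup.properlyDiscontinuousSMul_of_le ‹ProperlyDiscontinuousSMul Γ ℍ› Λ.le
  haveI : IsCancelSMul Λ.toSubgroup ℍ := isCancelSMul_of_le upperHalfPlane Γ Λ.le
  haveI := hN Λ
  -- «objects mapping to X.obj» = «objects mapping to ℍ/Λ̄» as object properties
  have hP : (fun Y : HolRS => Nonempty (Y ⟶ X.obj)) =
      fun Y : HolRS => Nonempty (Y ⟶ pslQuotient Λ.toSubgroup) := by
    funext Y
    refine propext ⟨fun ⟨f⟩ => ⟨f ≫ e.inv⟩, fun ⟨f⟩ => ⟨f ≫ e.hom⟩⟩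
  rw [hP]
  exact isIdRigid_mapsTo_pslQuotient_of_isSlimGroup Λ.toSubgroup (hfin_of_locObj Γ hfin Λ)
    (hslim Λ)

/-- ★ **The geometric `EA` over `X₀ = ℍ/Γ̄` is ID-RIGID** (Prop 4.2 (i) at the uniformised holomorphic
model), provided every finite-index `Λ̄ ≤ Γ̄` has `[N(Λ̄) : Λ̄] < ∞` and SLIM `N(Λ̄)^` ("Lemma 4.3" for the
orbicurves `[ℍ/N(Λ̄)]`; campaign-L, not proved here): print's deduction «objects mapping to `X`» id-rigid
for all `X` ⟹ `EA` id-rigid (abc-iut-L4-t14 gen-2 `HolRS.isIdRigid_EA_of_forall_isIdRigid_mapsTo`).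
[cite: MochizukiAbsTopIII2015, Proposition 4.2 (i) proof p.106] -/
theorem isIdRigid_EA_mapsTo_pslQuotient
    (hN : ∀ Λ : LocObj Γ,
      (Λ.toSubgroup.subgroupOf (Subgroup.normalizer (Λ.toSubgroup : Set PSL2R))).FiniteIndex)
    (hslim : ∀ Λ : LocObj Γ, IsSlimGroup (ProfiniteGrp.ProfiniteCompletion.completion
      (GrpCat.of (Subgroup.normalizer (Λ.toSubgroup : Set PSL2R))))) :
    IsIdRigid (geometricAutHolFieldFunctor fun Y : HolRS => Nonempty (Y ⟶ pslQuotient Γ)).EA :=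
  isIdRigid_EA_of_forall_isIdRigid_mapsTo _ (isIdRigid_mapsTo_in_EA_of Γ hfin hN hslim)

/-- ★ **[AbsTopIII] Cor 4.5 (i)–(v) for the archimedean log-Frobenius data over the geometric `EA` of
connected Riemann surfaces finite étale over `ℍ/Γ̄`**, under the same slimness hypotheses
(abc-iut-L4-t10's `cor_4_5_geometric` with `X₀ = ℍ/Γ̄` and the id-rigidity just proved).
[cite: MochizukiAbsTopIII2015, Corollary 4.5 pp.107–109] -/
theorem cor_4_5_geometric_mapsTo_pslQuotient
    (hN : ∀ Λ : LocObj Γ,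
      (Λ.toSubgroup.subgroupOf (Subgroup.normalizer (Λ.toSubgroup : Set PSL2R))).FiniteIndex)
    (hslim : ∀ Λ : LocObj Γ, IsSlimGroup (ProfiniteGrp.ProfiniteCompletion.completion
      (GrpCat.of (Subgroup.normalizer (Λ.toSubgroup : Set PSL2R))))) :
    Literature.AnabelianGeometry.AbsoluteAnabelian.AbsTopIII.Cor_4_5
      (archLogFrobeniusData (geometricAutHolFieldFunctor fun Y : HolRS => Nonempty (Y ⟶ pslQuotient Γ)))
      (archTelecoreData (geometricAutHolFieldFunctor fun Y : HolRS => Nonempty (Y ⟶ pslQuotient Γ))) :=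
  cor_4_5_geometric _ ⟨pslQuotient Γ, ⟨𝟙 _⟩⟩ (isIdRigid_EA_mapsTo_pslQuotient Γ hfin hN hslim)

end HolRS

end Literature.AnabelianGeometry.AbsoluteAnabelian

end
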